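import Summits.Ventures.PercRepro.Night2LocalDQm1ZeroStruct
import Summits.Ventures.PercRepro.Night2LocalD3ZeroFat

/-!
# PercRepro — the regime `|E ∖ G| = q − 1` on COLOOP-FREE flats, every `q ≥ 3`: the fat-pair count and the cell (night-2, gen 12)

Sequel of `Night2LocalDQm1Zero.lean`, the shadow sets `S` with at most one coloop (`M` loopless simple, `G` a rank-`(q+1)`
flat with `|E ∖ G| = q − 1`, `M|G` coloop-free):

* a loss at a covering set needs `q + 1` preimages, so the covering set is an independent `(q+1)`-set and `|S| = q + 2`
  (`card_eq_add_two_of_mem_ex2`); deleting a non-coloop of `S` leaves an independent set; the coloops of `S` lie in every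
  member carrying layer-2 weight; `G ∖ S ≠ ∅`;
* at most `q − 1` fat pairs through each non-coloop `t` (`card_fat_through_le`: `q` fat pairs would put a point of `G ∖ S`
  in the closure of the single remaining element of `S ∖ t`), so `2·#fat ≤ (q − 1)(q + 2 − a)` (`two_mul_card_fat_le_gen`);
* with `w₂ ≤ 2/(q+1)²` (fat) / `1/(q+1)²` (thin): `a = 0`: `load₂ ≤ q(q+2)/(q+1)² ≤ 1 = cap₂`; `a = 1`:
  `load₂ ≤ (2q−1)/(2(q+1)) ≤ (q²+q−1)/(q+1)² ≤ cap₂` (`load2_le_cap2_dqm1_zero_of_le_one`); with the middle columns of the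
  parent module: **`localShadowHall_dqm1_zero`** — THEOREM F: the local form (LI_G) at every rank-`(q+1)` flat `G` with
  `|E ∖ G| = q − 1` whose restriction `M|G` is coloop-free, for loopless simple `M` and every `q ≥ 3` (at `q = 4` this is
  `localShadowHall_d3_zero`).

Paper: `proofs/NIGHT-2-dq3.md` §6.
-/

open scoped Matroid

namespace PercRepro.Shadow

open Finset PerFlat ThmH

variable {α : Type*} [DecidableEq α] {M : Matroid α} [M.Finite]

section FatCount

variable {q : ℕ} {G S : Finset α}

open scoped Classical in
/-- **At most `q − 1` fat pairs through a non-coloop** of a `(q+2)`-element shadow set `S` with `S ∖ t` independent. -/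
theorem card_fat_through_le (hs : ∀ e ∈ gr M, ∀ f ∈ gr M, e ≠ f → rkN M {e, f} = 2)
    (hl : ∀ e ∈ gr M, M.Indep {e}) (hG : G ∈ flatsQ M (q + 1)) {d : ℕ} (hd : (gr M \ G).card = d)
    (hdq : d + 1 = q) (hS : S ∈ shadowAt M (q + 2) q (Uq M (q + 2) q) G) (hS6 : S.card = q + 2) {t : α}
    (ht : t ∈ S) (htI : M.Indep ((S.erase t : Finset α) : Set α)) :
    ((ex2 M q G S).filter (fun B => t ∉ B ∧ (G \ clF M B).card = 2)).card ≤ q - 1 := by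
  set F := (ex2 M q G S).filter (fun B => t ∉ B ∧ (G \ clF M B).card = 2) with hF
  set I := S.erase t with hI
  set J := I.filter (fun u => S \ {t, u} ∈ F) with hJ
  have hBu : ∀ B ∈ F, ∃ u ∈ J, S \ B = {t, u} := by
    intro B hB
    have hB' := hB
    rw [hF, Finset.mem_filter] at hB'
    obtain ⟨hBex, htB, hfat⟩ := hB'
    obtain ⟨-, -, hBS, -, hcard⟩ := mem_ex2_unpack hBex
    have htSB : t ∈ S \ B := Finset.mem_sdiff.2 ⟨ht, htB⟩
    obtain ⟨u, huSB, hut⟩ : ∃ u ∈ S \ B, u ≠ t := by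
      by_contra hno
      push Not at hno
      have hsub1 : S \ B ⊆ {t} := fun x hx => Finset.mem_singleton.2 (hno x hx)
      have := Finset.card_le_card hsub1
      rw [Finset.card_singleton] at this
      omega
    have hpair : S \ B = {t, u} := by
      symm
      apply Finset.eq_of_subset_of_card_le
      · intro x hx
        rw [Finset.mem_insert, Finset.mem_singleton] at hx
        rcases hx with rfl | rfl
        · exact htSB
        · exact huSB
      · rw [hcard, Finset.card_pair (Ne.symm hut)]
    refine ⟨u, ?_, hpair⟩
    rw [hJ, Finset.mem_filter, hI, Finset.mem_erase]
    refine ⟨⟨hut, (Finset.mem_sdiff.1 huSB).1⟩, ?_⟩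
    rw [← hpair, Finset.sdiff_sdiff_eq_self hBS]
    exact hB
  have hFJ : F.card ≤ J.card := by
    have hF' : F ⊆ J.image (fun u => S \ {t, u}) := by
      intro B hB
      obtain ⟨u, huJ, hpair⟩ := hBu B hB
      rw [Finset.mem_image]
      refine ⟨u, huJ, ?_⟩
      have hBS : B ⊆ S := by
        have := mem_ex2_unpack (Finset.mem_filter.1 (hF ▸ hB)).1
        exact this.2.2.1
      rw [← hpair, Finset.sdiff_sdiff_eq_self hBS]
    exact (Finset.card_le_card hF').trans Finset.card_image_le
  by_contra hlt
  push Not at hlt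
  have hJ4 : q ≤ J.card := by omega
  have hJI : J ⊆ I := Finset.filter_subset _ _
  have hIc : I.card = q + 1 := by rw [hI, Finset.card_erase_of_mem ht, hS6]; omega
  have hZc : (I \ J).card ≤ 1 := by
    have := Finset.card_sdiff_add_card_eq_card hJI
    omega
  have hq0 : 0 < q := by omega
  obtain ⟨u₀, hu₀⟩ := Finset.card_pos.1 (by omega : 0 < J.card)
  have hu₀F : S \ {t, u₀} ∈ F := (Finset.mem_filter.1 hu₀).2
  have hu₀ex : S \ {t, u₀} ∈ ex2 M q G S := (Finset.mem_filter.1 hu₀F).1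
  obtain ⟨p, hpG, hpS⟩ := exists_mem_sdiff_of_mem_ex2_gen hG hd hdq hS hu₀ex
  have hpcl : ∀ u ∈ J, p ∈ clF M (I.erase u) := by
    intro u hu
    have huF : S \ {t, u} ∈ F := (Finset.mem_filter.1 hu).2
    have huex : S \ {t, u} ∈ ex2 M q G S := (Finset.mem_filter.1 huF).1
    have hfat : (G \ clF M (S \ {t, u})).card = 2 := (Finset.mem_filter.1 huF).2.2
    obtain ⟨-, -, hBS, hsub, hcard⟩ := mem_ex2_unpack huex
    have heq : G \ clF M (S \ {t, u}) = S \ (S \ {t, u}) :=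
      (Finset.eq_of_subset_of_card_le hsub (by omega)).symm
    have hIu : I.erase u = S \ {t, u} := by
      ext x
      rw [hI, Finset.mem_erase, Finset.mem_erase, Finset.mem_sdiff, Finset.mem_insert, Finset.mem_singleton]
      tauto
    rw [hIu]
    by_contra hpcl'
    have hmem : p ∈ G \ clF M (S \ {t, u}) := Finset.mem_sdiff.2 ⟨hpG, hpcl'⟩
    rw [heq] at hmem
    exact hpS (Finset.mem_sdiff.1 hmem).1
  have hpI : p ∈ clF M I := clF_mono (Finset.erase_subset u₀ I) (hpcl u₀ hu₀)
  have hpI' : p ∉ I := fun h => hpS (Finset.mem_of_mem_erase h)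
  exact not_mem_clF_all_but_one hs hl htI hJI hZc hpI hpcl hpI'

open scoped Classical in
/-- **The fat-pair count at `d = q − 1`**: `2·#fat ≤ (q − 1)(q + 2 − a)` at a `(q+2)`-element shadow set with `a`
coloops (`M|G` coloop-free). -/
theorem two_mul_card_fat_le_gen (hs : ∀ e ∈ gr M, ∀ f ∈ gr M, e ≠ f → rkN M {e, f} = 2)
    (hl : ∀ e ∈ gr M, M.Indep {e}) (hG : G ∈ flatsQ M (q + 1)) {d : ℕ} (hd : (gr M \ G).card = d)
    (hdq : d + 1 = q) (hS : S ∈ shadowAt M (q + 2) q (Uq M (q + 2) q) G) (hS6 : S.card = q + 2) :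
    2 * ((ex2 M q G S).filter (fun B => (G \ clF M B).card = 2)).card ≤ (q - 1) * (q + 2 - (coloops M S).card) := by
  set F := (ex2 M q G S).filter (fun B => (G \ clF M B).card = 2) with hF
  have hF2 : ∀ B ∈ F, (S \ B).card = 2 := fun B hB => (mem_ex2_unpack (Finset.mem_filter.1 hB).1).2.2.2.2
  rw [two_mul_card_fat_eq S F hF2]
  have hbound : ∀ t ∈ S, (F.filter (fun B => t ∉ B)).card ≤ if t ∈ coloops M S then 0 else q - 1 := by
    intro t ht
    split_ifs with htc
    · apply le_of_eq
      rw [Finset.card_eq_zero, Finset.filter_eq_empty_iff]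
      intro B hB htB
      exact htB (mem_of_mem_ex2_of_mem_coloops_gen hG hS (Finset.mem_filter.1 hB).1 htc)
    · have htI := indep_erase_of_not_coloop_gen hG hS hS6 ht htc
      have h3 := card_fat_through_le hs hl hG hd hdq hS hS6 ht htI
      refine le_trans (Finset.card_le_card ?_) h3
      intro B hB
      rw [Finset.mem_filter] at hB ⊢
      rw [hF, Finset.mem_filter] at hB
      exact ⟨hB.1.1, hB.2, hB.1.2⟩
  refine (Finset.sum_le_sum hbound).trans ?_
  rw [Finset.sum_ite, Finset.sum_const, Finset.sum_const, smul_zero, zero_add, smul_eq_mul]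
  have hcol : (S.filter (fun t => t ∈ coloops M S)) = coloops M S := by
    ext x
    rw [Finset.mem_filter]
    exact ⟨fun h => h.2, fun h => ⟨coloops_subset_self S h, h⟩⟩
  have hsplit := Finset.card_filter_add_card_filter_not (s := S) (fun t => t ∈ coloops M S)
  rw [hcol] at hsplit
  have hcS : (coloops M S).card ≤ q + 2 := by
    have := Finset.card_le_card (coloops_subset_self (M := M) S); omega
  rw [mul_comm]
  have : (S.filter (fun t => ¬ t ∈ coloops M S)).card = q + 2 - (coloops M S).card := by omega
  rw [this]

open scoped Classical in
/-- **The column bound at `d = q − 1`, no coloop of `M|G`, at most one coloop of `S`** (loopless simple `M`, `q ≥ 3`). -/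
theorem load2_le_cap2_dqm1_zero_of_le_one (hq : 3 ≤ q) (hs : ∀ e ∈ gr M, ∀ f ∈ gr M, e ≠ f → rkN M {e, f} = 2)
    (hl : ∀ e ∈ gr M, M.Indep {e}) (hG : G ∈ flatsQ M (q + 1)) {d : ℕ} (hd : (gr M \ G).card = d)
    (hdq : d + 1 = q) (hk : kColoops M G = 0) (hS : S ∈ shadowAt M (q + 2) q (Uq M (q + 2) q) G)
    (ha : (coloops M S).card ≤ 1) : load2 M q G S ≤ cap2 M q G S := by
  have hcap := cap2_ge_dqm1_zero hG hd hdq hk S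
  have hcap0 := cap2_nonneg_dqm1_zero (q := q) hk S
  have hq1 : (0 : ℚ) < ((q : ℚ) + 1) ^ 2 := by positivity
  have hq3 : (3 : ℚ) ≤ (q : ℚ) := by exact_mod_cast hq
  rcases Finset.eq_empty_or_nonempty (ex2 M q G S) with hemp | ⟨B₀, hB₀⟩
  · have hload := load2_le_card_ex2_mul (M := M) (q := q) (G := G) (S := S) (c := 0)
      (fun B hB => by rw [hemp] at hB; exact absurd hB (Finset.notMem_empty B))
    rw [hemp, Finset.card_empty] at hload
    simp only [Nat.cast_zero, zero_mul] at hload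
    exact hload.trans hcap0
  · have hS6 : S.card = q + 2 := card_eq_add_two_of_mem_ex2 hl hG hd hdq hk hB₀
    have hex := two_mul_card_ex2_le hG hS
    have hfat := two_mul_card_fat_le_gen hs hl hG hd hdq hS hS6
    set F := (ex2 M q G S).filter (fun B => (G \ clF M B).card = 2) with hF
    have hw : ∀ B ∈ ex2 M q G S,
        w2 M q G B S ≤ if (G \ clF M B).card = 2 then (2 : ℚ) / (((q : ℚ) + 1) ^ 2) else 1 / (((q : ℚ) + 1) ^ 2) := by
      intro B hB
      split_ifs with h2
      · exact w2_le_two_div_dqm1_zero hG hd hdq hk hB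
      · have hm : 2 ≤ (G \ clF M B).card := by
          obtain ⟨-, -, -, hsub, hcard⟩ := mem_ex2_unpack hB
          exact hcard ▸ Finset.card_le_card hsub
        exact w2_le_one_div_dqm1_zero hG hd hdq hk hB (by omega)
    have hload : load2 M q G S ≤
        ∑ B ∈ ex2 M q G S, (if (G \ clF M B).card = 2 then (2 : ℚ) / (((q : ℚ) + 1) ^ 2)
          else 1 / (((q : ℚ) + 1) ^ 2)) := by
      unfold load2
      rw [← Finset.sum_filter_ne_zero]
      exact Finset.sum_le_sum (fun B hB => hw B hB)
    rw [Finset.sum_ite, Finset.sum_const, Finset.sum_const, nsmul_eq_mul, nsmul_eq_mul] at hload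
    have hsplit := Finset.card_filter_add_card_filter_not (s := ex2 M q G S) (fun B => (G \ clF M B).card = 2)
    obtain ⟨a, ha'⟩ : ∃ a, (coloops M S).card = a := ⟨_, rfl⟩
    rw [ha'] at hex hcap ha hfat
    have hFq : ((ex2 M q G S).filter (fun B => (G \ clF M B).card = 2)).card = F.card := rfl
    have hTq : ((ex2 M q G S).filter (fun B => ¬ (G \ clF M B).card = 2)).card =
        (ex2 M q G S).card - F.card := by omega
    rw [hFq, hTq] at hload
    have hFle : F.card ≤ (ex2 M q G S).card := by omega
    have hcast : (((ex2 M q G S).card - F.card : ℕ) : ℚ) = ((ex2 M q G S).card : ℚ) - (F.card : ℚ) := by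
      rw [Nat.cast_sub hFle]
    rw [hcast] at hload
    -- `load₂ ≤ (e + F)/(q+1)²`
    have hload' : load2 M q G S ≤ (((ex2 M q G S).card : ℚ) + (F.card : ℚ)) / (((q : ℚ) + 1) ^ 2) := by
      refine hload.trans (le_of_eq ?_)
      field_simp
      ring
    -- the integer bounds, cast
    have he' : (2 * (ex2 M q G S).card : ℚ) ≤ ((q : ℚ) + 2 - (a : ℚ)) * ((q : ℚ) + 1 - (a : ℚ)) := by
      have h2 : ((q + 2 - a) * (q + 1 - a) : ℕ) = ((q : ℚ) + 2 - (a : ℚ)) * ((q : ℚ) + 1 - (a : ℚ)) := by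
        rw [Nat.cast_mul, Nat.cast_sub (by omega), Nat.cast_sub (by omega)]; push_cast; ring
      rw [← h2]; exact_mod_cast hex
    have hf' : (2 * F.card : ℚ) ≤ ((q : ℚ) - 1) * ((q : ℚ) + 2 - (a : ℚ)) := by
      have h2 : ((q - 1) * (q + 2 - a) : ℕ) = ((q : ℚ) - 1) * ((q : ℚ) + 2 - (a : ℚ)) := by
        rw [Nat.cast_mul, Nat.cast_sub (by omega), Nat.cast_sub (by omega)]; push_cast; ring
      rw [← h2]; exact_mod_cast hfat
    have ha1 : (a : ℚ) ≤ 1 := by exact_mod_cast ha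
    have ha0 : (0 : ℚ) ≤ (a : ℚ) := by positivity
    -- (e + F)/(q+1)² ≤ 1 − a(q+2)/(q+1)²  ⟸  2(e + F) ≤ 2(q+1)² − 2a(q+2), for a ∈ {0, 1}
    have hkey : ((ex2 M q G S).card : ℚ) + (F.card : ℚ) ≤ ((q : ℚ) + 1) ^ 2 - (a : ℚ) * ((q : ℚ) + 2) := by
      rcases Nat.le_one_iff_eq_zero_or_eq_one.1 ha with rfl | rfl
      · push_cast at he' hf' ⊢
        nlinarith
      · push_cast at he' hf' ⊢
        nlinarith
    have hfin : (((ex2 M q G S).card : ℚ) + (F.card : ℚ)) / (((q : ℚ) + 1) ^ 2) ≤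
        1 - (a : ℚ) * (((q : ℚ) + 2) / (((q : ℚ) + 1) ^ 2)) := by
      have hr : 1 - (a : ℚ) * (((q : ℚ) + 2) / (((q : ℚ) + 1) ^ 2)) =
          (((q : ℚ) + 1) ^ 2 - (a : ℚ) * ((q : ℚ) + 2)) / (((q : ℚ) + 1) ^ 2) := by
        field_simp
      rw [hr]
      exact div_le_div_of_nonneg_right hkey hq1.le
    linarith

open scoped Classical in
/-- **The column bound at `d = q − 1` on coloop-free flats** (loopless simple `M`, `q ≥ 3`), every shadow set. -/
theorem load2_le_cap2_dqm1_zero (hq : 3 ≤ q) (hs : ∀ e ∈ gr M, ∀ f ∈ gr M, e ≠ f → rkN M {e, f} = 2)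
    (hl : ∀ e ∈ gr M, M.Indep {e}) (hG : G ∈ flatsQ M (q + 1)) {d : ℕ} (hd : (gr M \ G).card = d)
    (hdq : d + 1 = q) (hk : kColoops M G = 0) (hS : S ∈ shadowAt M (q + 2) q (Uq M (q + 2) q) G) :
    load2 M q G S ≤ cap2 M q G S := by
  rcases Nat.lt_or_ge (coloops M S).card 2 with h | h
  · exact load2_le_cap2_dqm1_zero_of_le_one hq hs hl hG hd hdq hk hS (by omega)
  · exact load2_le_cap2_dqm1_zero_of_two_le hq hs hG hd hdq hk hS h

/-- **THEOREM F — THE COLOOP-FREE CELL OF THE REGIME `|E ∖ G| = q − 1`, EVERY `q ≥ 3`**: the local form (LI_G) holds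
at every rank-`(q+1)` flat `G` with `|E ∖ G| = q − 1` whose restriction `M|G` has no coloop, for a loopless simple
matroid — by the distance-2 rule. -/
theorem localShadowHall_dqm1_zero (hq : 3 ≤ q) (hs : ∀ e ∈ gr M, ∀ f ∈ gr M, e ≠ f → rkN M {e, f} = 2)
    (hl : ∀ e ∈ gr M, M.Indep {e}) (hG : G ∈ flatsQ M (q + 1)) (hd : (gr M \ G).card + 1 = q)
    (hk : kColoops M G = 0) : LocalShadowHall M q G := by
  classical
  apply localShadowHall_of_distance_two hG (by omega)
  intro S hS
  exact load2_le_cap2_dqm1_zero hq hs hl hG rfl hd hk hS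

end FatCount

end PercRepro.Shadow
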